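import Literature.NumberTheory.Automorphic.LevelActionShapiro
import Literature.NumberTheory.Automorphic.ArithmeticQuotientCohomologyFinite
import Literature.NumberTheory.Automorphic.HidaTowerLevels
import Literature.Algebra.Homology.GroupCohomologyRestrictScalars
import Literature.Algebra.Homology.GroupCohomologyModPiFinite
import HarnessLib

/-!
# Finiteness of `H^i(U, τ)` (coefficients at `p`) for `GL₂` over a number field, given Borel–Serre

Topic `NumberTheory/Automorphic`; namespace `Literature.NumberTheory.Automorphic.LevelAction` and
`….BigHeckeGLn.TameLevel`; theorems only.  Assembly, for the level-action ("coefficients at `p`")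
model `LevelAction.cohomology ι Δ τ U i = H^i(GL₂(K), M(U, τ))` of `IntegralWeightHeckeModuleGL2`
with ARBITRARY finite coefficients `V` on which only `U ⊆ Δ` acts (e.g. the torsion coefficients
`Sym^{k-2}(𝒪/ϖ^r)²` of Hida theory, [Hida1994AIF, §2]; [KhareThorne2017, §6.3–6.4]):

* `LevelAction.finite_cohomology_two_of_borelSerre` — **`H^i(U, τ)` is finite** for `GL₂` over a
  number field `K`, `U` compact open, `V` finite, GIVEN the Borel–Serre finiteness of the cohomology
  of congruence subgroups with finite coefficients
  (`BorelSerre1973_finite_groupCohomology_congruenceSubgroup`): finitely many double cosets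
  `GL₂(K) x U` (`BigHeckeGLn.exists_finset_orbit_cover_two`), Shapiro for the level-action model
  (`LevelAction.finite_cohomology_of_finite_cover`, `LevelActionShapiro`), the stabilisers
  `Γ_x = GL₂(K) ∩ x U x⁻¹` being the congruence subgroups of the compact open stabilisers of the
  cosets `x U` (`TwistedQuotient.isOpen_stabilizer_coe`, `isCompact_stabilizer_coe`), and the
  independence of the finiteness of `H^i(Γ_x, V)` from the ring of scalars
  (`finite_groupCohomology_iff_intRep`, `GroupCohomologyRestrictScalars`);
* `TameLevel.finite_levelActionCohomology_level_of_borelSerre` — in particular for the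
  two-parameter Hida levels `U(b, c)` (`HidaTowerLevels`);
* `LevelAction.moduleFinite_cohomology_two_of_borelSerre` — **`H^i(U, τ)` is a finitely generated
  `R`-module for `ϖ`-ADIC LATTICE coefficients** (`R` and `V` `ϖ`-adically complete, `V` separated and
  `ϖ`-torsion-free with `V/ϖV` finite, e.g. `Sym^{k-2} 𝒪²`), GIVEN the named fact: the stabiliser
  cohomology `H^i(Γ_x, V)` is finitely generated by the adic Nakayama lemma on cochains
  (`moduleFinite_of_finite_cohomology_quotient`, `GroupCohomologyModPiFinite`) since
  `H^i(Γ_x, V/ϖV)` is finite (Borel–Serre), then Shapiro (`moduleFinite_cohomology_of_finite_cover`).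

This discharges, given the named fact, the `[Finite]` hypotheses of the independence-of-weight /
Hida-lemma statements of the tree at torsion level (`HidaIndependenceOfWeightOrdinary`,
`HidaLemmaGL2`).

## References

* A. Borel, J.-P. Serre, *Corners and arithmetic groups*, Comment. Math. Helv. 48 (1973), §11.1.
  [BorelSerre1973]
* H. Hida, *p-adic ordinary Hecke algebras for GL(2)*, Ann. Inst. Fourier 44 (1994), §2 (held).
  [Hida1994AIF]
* C. Khare, J. A. Thorne, Amer. J. Math. 139 (2017), §6.3–6.4 (arXiv:1409.7007, held).
  [KhareThorne2017]
-/

noncomputable section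

open CategoryTheory
open scoped NumberField Pointwise
open IsDedekindDomain

namespace Literature.NumberTheory.Automorphic

open BigHeckeGLn Literature.Algebra.Homology

namespace LevelAction

/-- **`H^i(U, τ)` is finite for `GL₂` over a number field, `U` compact open and `V` finite**,
GIVEN `BorelSerre1973_finite_groupCohomology_congruenceSubgroup`. [cite: BorelSerre1973, §11.1]
[cite: Hida1994AIF, §2] -/
theorem finite_cohomology_two_of_borelSerre
    (h : BorelSerre1973_finite_groupCohomology_congruenceSubgroup)
    (K : Type) [Field K] [NumberField K] {R : Type} [CommRing R]
    (U : Subgroup (FiniteAdelicGL 2 K)) (hUo : IsOpen (U : Set (FiniteAdelicGL 2 K)))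
    (hUc : IsCompact (U : Set (FiniteAdelicGL 2 K))) (Δ : Submonoid (FiniteAdelicGL 2 K))
    (hU : U.toSubmonoid ≤ Δ) {V : Type} [AddCommGroup V] [Module R V] [Finite V]
    (τ : Δ →* Module.End R V) (i : ℕ) :
    Finite (cohomology (globalEmbedding 2 K) Δ τ U i) := by
  classical
  obtain ⟨s₀, hcov⟩ := exists_finset_orbit_cover_two K U hUo
  refine finite_cohomology_of_finite_cover (globalEmbedding 2 K) Δ τ U hU (s₀.image Quotient.out)
    (fun g => ?_) i fun x _ => ?_
  · obtain ⟨c, hc, γ, hγ⟩ := hcov (g : FiniteAdelicGL 2 K ⧸ U)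
    refine ⟨c.out, Finset.mem_image_of_mem _ hc, γ, ?_⟩
    rw [QuotientGroup.out_eq']
    exact hγ
  · rw [finite_groupCohomology_iff_intRep]
    haveI : Finite (intRep (stabilizerRep (globalEmbedding 2 K) Δ τ U hU x)) := ‹Finite V›
    exact h 2 K (MulAction.stabilizer (FiniteAdelicGL 2 K) (x : FiniteAdelicGL 2 K ⧸ U))
      (TwistedQuotient.isOpen_stabilizer_coe U hUo _) (TwistedQuotient.isCompact_stabilizer_coe U hUc _)
      _ this i

/-- **`H^i(U, τ)` is finitely generated over `R` for `ϖ`-adic lattice coefficients** (`GL₂` over a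
number field, `U` compact open; `R`, `V` `ϖ`-adically complete, `V` separated, `ϖ`-torsion-free,
`V/ϖV` finite), GIVEN `BorelSerre1973_finite_groupCohomology_congruenceSubgroup`.
[cite: BorelSerre1973, §11.1] [cite: Hida1994AIF, §2] -/
theorem moduleFinite_cohomology_two_of_borelSerre
    (h : BorelSerre1973_finite_groupCohomology_congruenceSubgroup)
    (K : Type) [Field K] [NumberField K] {R : Type} [CommRing R] (ϖ : R)
    [IsPrecomplete (Ideal.span {ϖ}) R]
    (U : Subgroup (FiniteAdelicGL 2 K)) (hUo : IsOpen (U : Set (FiniteAdelicGL 2 K)))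
    (hUc : IsCompact (U : Set (FiniteAdelicGL 2 K))) (Δ : Submonoid (FiniteAdelicGL 2 K))
    (hU : U.toSubmonoid ≤ Δ) {V : Type} [AddCommGroup V] [Module R V]
    [IsAdicComplete (Ideal.span {ϖ}) V] (htf : ∀ v : V, ϖ • v = 0 → v = 0)
    (hfin : Finite (V ⧸ (ϖ • ⊤ : Submodule R V)))
    (τ : Δ →* Module.End R V) (i : ℕ) :
    Module.Finite R (cohomology (globalEmbedding 2 K) Δ τ U i) := by
  classical
  obtain ⟨s₀, hcov⟩ := exists_finset_orbit_cover_two K U hUo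
  refine moduleFinite_cohomology_of_finite_cover (globalEmbedding 2 K) Δ τ U hU
    (s₀.image Quotient.out) (fun g => ?_) i fun x _ => ?_
  · obtain ⟨c, hc, γ, hγ⟩ := hcov (g : FiniteAdelicGL 2 K ⧸ U)
    refine ⟨c.out, Finset.mem_image_of_mem _ hc, γ, ?_⟩
    rw [QuotientGroup.out_eq']
    exact hγ
  · -- the stabiliser cohomology with coefficients `V/ϖV` is finite (Borel–Serre), hence `H^i(Γ_x, V)`
    -- is finitely generated by the adic Nakayama lemma on cochains
    set A := stabilizerRep (globalEmbedding 2 K) Δ τ U hU x with hA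
    haveI : IsAdicComplete (Ideal.span {ϖ}) A.V := ‹IsAdicComplete (Ideal.span {ϖ}) V›
    refine moduleFinite_of_finite_cohomology_quotient A ϖ htf i ?_
    rw [finite_groupCohomology_iff_intRep]
    haveI : Finite (intRep (A.quotient (ϖ • ⊤) (smul_top_le_comap A ϖ))) := hfin
    exact h 2 K (MulAction.stabilizer (FiniteAdelicGL 2 K) (x : FiniteAdelicGL 2 K ⧸ U))
      (TwistedQuotient.isOpen_stabilizer_coe U hUo _) (TwistedQuotient.isCompact_stabilizer_coe U hUc _)
      _ this i

end LevelAction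

namespace BigHeckeGLn.TameLevel

/-- **`H^i(U(b, c), τ)` is finite** for the two-parameter Hida levels of `GL₂` over a number field
and finite coefficients, GIVEN `BorelSerre1973_finite_groupCohomology_congruenceSubgroup`.
[cite: BorelSerre1973, §11.1] [cite: KhareThorne2017, §6.3] -/
theorem finite_levelActionCohomology_level_of_borelSerre
    (h : BorelSerre1973_finite_groupCohomology_congruenceSubgroup)
    (K : Type) [Field K] [NumberField K] (p : ℕ) [Fact p.Prime] (𝒰 : TameLevel 2 K p) (b c : ℕ)
    {R : Type} [CommRing R] (Δ : Submonoid (FiniteAdelicGL 2 K))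
    (hU : (𝒰.level b c).toSubmonoid ≤ Δ) {V : Type} [AddCommGroup V] [Module R V] [Finite V]
    (τ : Δ →* Module.End R V) (i : ℕ) :
    Finite (LevelAction.cohomology (globalEmbedding 2 K) Δ τ (𝒰.level b c) i) :=
  LevelAction.finite_cohomology_two_of_borelSerre h K (𝒰.level b c) (𝒰.isOpen_level b c)
    (𝒰.isCompact_level b c) Δ hU τ i

end BigHeckeGLn.TameLevel

end Literature.NumberTheory.Automorphic
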